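import Summits.RiemannHypothesis.RiemannHypothesis.Theorems.HandoffDodgerProfileBound
import HarnessLib

/-!
# HANDOFF — the PROFILE LOWER BOUND with an ABSTRACT main-range majorant (rh-explicit, W-P(P2) crux 19185, seat dodger-p2 gen0; DODGER-STAGE2-PLAN §2 (c) brick B3-iii-a)

RH-FREE. HONEST FRAMING: nothing here bears on the truth of RH; elementary real analysis on a power series, the twin of gen10's
`HandoffDodgerProfileBound.profile_lower_bound` (ATTEMPT-16 Lemma D1 in parametric form). gen10 hard-codes the main-range majorant
`exp(2PWm²/p²) − 1` of the GEOMETRIC cumulant bound. THIS FILE proves the same conclusion `S ≥ (1 − η − 3τ₁ − τ₂)·Φ` from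

  (H1) `|b_m − p^m/m!| ≤ (p^m/m!)·(exp(g m) − 1)` for `m ≤ N₂`,   (H2) `|b_m| ≤ E·(2W)^m` for `m > N₂`,

for ANY `g ≥ 0` with `g m ≤ g N₁` on `m ≤ N₁` and `g m ≤ λ·m` on `N₁ < m ≤ N₂` (`η ≥ exp(g N₁) − 1`; the other parameters as in
gen10) — so that the COUNTING cumulant bound of `HandoffDodgerCountingMajorant` (`g m = A(Vm/p)²/(1 − Vm/p)`, ATTEMPT-16 Lemma B3/D1)
can be fed in (`profile_lower_bound_of_majorant`). The proof is gen10's verbatim except the three lines where the majorant enters.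
No `sorry`, standard axioms, no definitions.

References: this track (ATTEMPT-16 §5 Lemma D1; ATTEMPT-19 §4; HOME/rh-explicit-dodger-p2/DODGER-STAGE2-PLAN.md §2).
-/

set_option linter.dupNamespace false

noncomputable section

open Finset Real Filter
open scoped Topology

namespace Summit.RiemannHypothesis.RiemannHypothesis.Theorems.Handoff

/-! ## The profile lower bound with an abstract majorant -/

set_option maxHeartbeats 400000 in
/-- **ATTEMPT-16 Lemma D1, parametric form with an ABSTRACT majorant `g`.** As gen10's `profile_lower_bound`, with the main-range
hypothesis `|b_m − p^m/m!| ≤ (p^m/m!)(exp(g m) − 1)` for an arbitrary `g ≥ 0` that is dominated by `g N₁` on `m ≤ N₁` and by `λ·m` on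
`N₁ < m ≤ N₂` (gen10: `g m = 2PWm²/p²`; the COUNTING chain: `g m = A(Vm/p)²/(1 − Vm/p)`). [this track, ATTEMPT-16 §5 Lemma D1; ATTEMPT-19 §4; DODGER-STAGE2-PLAN §2] -/
theorem profile_lower_bound_of_majorant {b : ℕ → ℝ} {g : ℕ → ℝ} {p W X σ E η lam ρ₁ ρ₂ τ₁ τ₂ : ℝ} {N₁ N₂ : ℕ}
    (hp : 0 < p) (hW : 0 ≤ W) (hE : 0 ≤ E) (hN : N₁ ≤ N₂)
    (H1 : ∀ m : ℕ, m ≤ N₂ →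
      |b m - p ^ m / (m.factorial : ℝ)| ≤ p ^ m / (m.factorial : ℝ) * (Real.exp (g m) - 1))
    (H2 : ∀ m : ℕ, N₂ < m → |b m| ≤ E * (2 * W) ^ m)
    (hg0 : ∀ m : ℕ, 0 ≤ g m) (hgmono : ∀ m : ℕ, m ≤ N₁ → g m ≤ g N₁) (hlam0 : 0 ≤ lam)
    (hglam : ∀ m : ℕ, N₁ < m → m ≤ N₂ → g m ≤ lam * m)
    (hσ : 0 ≤ σ) (hσX : p * σ ^ 2 ≤ X)
    (hη : Real.exp (g N₁) - 1 ≤ η)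
    (hρ₁ : Real.exp (3 + lam) * X / (4 * ((N₁ : ℝ) + 1) ^ 3) ≤ ρ₁) (hρ₁1 : ρ₁ < 1)
    (hρ₂ : Real.exp 2 * W * σ ^ 2 / (2 * ((N₂ : ℝ) + 1) ^ 2) ≤ ρ₂) (hρ₂1 : ρ₂ < 1)
    (hτ₁ : ρ₁ ^ (N₁ + 1) / (1 - ρ₁) ≤ τ₁) (hτ₂ : E * ρ₂ ^ (N₂ + 1) / (1 - ρ₂) ≤ τ₂)
    {S : ℝ} (hS : HasSum (fun m : ℕ => b m * σ ^ (2 * m) / ((2 * m).factorial : ℝ)) S)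
    {Φ : ℝ} (hΦ : HasSum (fun m : ℕ => (p * σ ^ 2) ^ m / ((m.factorial : ℝ) * ((2 * m).factorial : ℝ))) Φ) :
    (1 - η - 3 * τ₁ - τ₂) * Φ ≤ S := by
  -- notation
  set x := p * σ ^ 2 with hx
  have hx0 : 0 ≤ x := by positivity
  have hX0 : 0 ≤ X := hx0.trans hσX
  set κ := 1 - η - 3 * τ₁ - τ₂ with hκ
  set f : ℕ → ℝ := fun m => b m * σ ^ (2 * m) / ((2 * m).factorial : ℝ) with hf
  set t : ℕ → ℝ := fun m => x ^ m / ((m.factorial : ℝ) * ((2 * m).factorial : ℝ)) with ht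
  have hρ₁0 : 0 ≤ ρ₁ := le_trans (by positivity) hρ₁
  have hρ₂0 : 0 ≤ ρ₂ := le_trans (by positivity) hρ₂
  have hη0 : 0 ≤ η := le_trans (by linarith [Real.one_le_exp (hg0 N₁)]) hη
  have hτ₁0 : 0 ≤ τ₁ := le_trans (div_nonneg (pow_nonneg hρ₁0 _) (by linarith)) hτ₁
  have hτ₂0 : 0 ≤ τ₂ := le_trans (div_nonneg (mul_nonneg hE (pow_nonneg hρ₂0 _)) (by linarith)) hτ₂
  have hκ1 : κ ≤ 1 := by simp only [hκ]; linarith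
  have ht0 : ∀ m, 0 ≤ t m := fun m => by positivity
  -- the term identity `t m = (p^m/m!)·σ^{2m}/(2m)!`
  have htm : ∀ m, t m = p ^ m / (m.factorial : ℝ) * (σ ^ (2 * m) / ((2 * m).factorial : ℝ)) :=
    fun m => profileTerm_mul_sq p σ m
  -- (A) main range: `|f m − t m| ≤ t m·(e^{g_m} − 1)` for `m ≤ N₂`
  have hA : ∀ m, m ≤ N₂ → |f m - t m| ≤ t m * (Real.exp (g m) - 1) := by
    intro m hm
    have hw : 0 ≤ σ ^ (2 * m) / ((2 * m).factorial : ℝ) := by positivity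
    have e : f m - t m = (b m - p ^ m / (m.factorial : ℝ)) * (σ ^ (2 * m) / ((2 * m).factorial : ℝ)) := by
      simp only [hf, htm]; ring
    rw [e, abs_mul, abs_of_nonneg hw, htm m]
    calc |b m - p ^ m / (m.factorial : ℝ)| * (σ ^ (2 * m) / ((2 * m).factorial : ℝ))
        ≤ p ^ m / (m.factorial : ℝ) * (Real.exp (g m) - 1) *
            (σ ^ (2 * m) / ((2 * m).factorial : ℝ)) := mul_le_mul_of_nonneg_right (H1 m hm) hw
      _ = p ^ m / (m.factorial : ℝ) * (σ ^ (2 * m) / ((2 * m).factorial : ℝ)) *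
            (Real.exp (g m) - 1) := by ring
  -- (A1) `m ≤ N₁`: `f m ≥ (1 − η)·t m`
  have hA1 : ∀ m, m ≤ N₁ → (1 - η) * t m ≤ f m := by
    intro m hm
    have h := hA m (hm.trans hN)
    have hg : Real.exp (g m) - 1 ≤ η := by
      refine le_trans ?_ hη
      linarith [Real.exp_le_exp.2 (hgmono m hm)]
    have h' := (abs_le.1 h).1
    nlinarith [ht0 m, mul_le_mul_of_nonneg_left hg (ht0 m)]
  -- (A2) `N₁ < m ≤ N₂`: `|f m| ≤ t m · e^{λ m} ≤ ρ₁^m`, and `t m ≤ ρ₁^m`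
  have htρ : ∀ m, N₁ < m → t m * Real.exp (lam * m) ≤ ρ₁ ^ m ∧ t m ≤ ρ₁ ^ m := by
    intro m hm
    have hm1 : 1 ≤ m := by omega
    have hm0 : (0 : ℝ) < m := by exact_mod_cast hm1
    have hmN : ((N₁ : ℝ) + 1) ≤ m := by exact_mod_cast hm
    have h1 : t m ≤ (Real.exp 3 * x / (4 * (m : ℝ) ^ 3)) ^ m := profileTerm_le_pow hx0 hm1
    -- the base `e³x/(4m³)·e^λ ≤ ρ₁`
    have hbase : Real.exp 3 * x / (4 * (m : ℝ) ^ 3) * Real.exp lam ≤ ρ₁ := by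
      refine le_trans ?_ hρ₁
      rw [Real.exp_add]
      have hm3 : ((N₁ : ℝ) + 1) ^ 3 ≤ (m : ℝ) ^ 3 := by gcongr
      calc Real.exp 3 * x / (4 * (m : ℝ) ^ 3) * Real.exp lam
          = Real.exp 3 * Real.exp lam * x / (4 * (m : ℝ) ^ 3) := by ring
        _ ≤ Real.exp 3 * Real.exp lam * X / (4 * (m : ℝ) ^ 3) := by gcongr
        _ ≤ Real.exp 3 * Real.exp lam * X / (4 * ((N₁ : ℝ) + 1) ^ 3) := by
            apply div_le_div_of_nonneg_left (by positivity) (by positivity)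
            linarith
    have hbase0 : 0 ≤ Real.exp 3 * x / (4 * (m : ℝ) ^ 3) := by positivity
    have hbase' : Real.exp 3 * x / (4 * (m : ℝ) ^ 3) ≤ ρ₁ :=
      le_trans (le_mul_of_one_le_right hbase0 (Real.one_le_exp hlam0)) hbase
    constructor
    · rw [show Real.exp (lam * m) = Real.exp lam ^ m by rw [← Real.exp_nat_mul]; ring_nf]
      calc t m * Real.exp lam ^ m ≤ (Real.exp 3 * x / (4 * (m : ℝ) ^ 3)) ^ m * Real.exp lam ^ m :=
            mul_le_mul_of_nonneg_right h1 (by positivity)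
        _ = (Real.exp 3 * x / (4 * (m : ℝ) ^ 3) * Real.exp lam) ^ m := by rw [mul_pow]
        _ ≤ ρ₁ ^ m := pow_le_pow_left₀ (by positivity) hbase m
    · exact h1.trans (pow_le_pow_left₀ hbase0 hbase' m)
  have hA2 : ∀ m, N₁ < m → m ≤ N₂ → -(2 * ρ₁ ^ m) ≤ f m - κ * t m := by
    intro m hm1 hm2
    have h := hA m hm2
    obtain ⟨hρa, hρb⟩ := htρ m hm1
    have hg : Real.exp (g m) ≤ Real.exp (lam * m) := Real.exp_le_exp.2 (hglam m hm1 hm2)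
    -- `|f m| ≤ t m · e^{g_m} ≤ t m · e^{λm} ≤ ρ₁^m`
    have hfabs : |f m| ≤ ρ₁ ^ m := by
      have h1 : |f m| ≤ |f m - t m| + |t m| := by
        have := abs_add_le (f m - t m) (t m); rwa [sub_add_cancel] at this
      rw [abs_of_nonneg (ht0 m)] at h1
      have h2 : |f m - t m| + t m ≤ t m * Real.exp (g m) := by nlinarith [ht0 m]
      have h3 : t m * Real.exp (g m) ≤ t m * Real.exp (lam * m) :=
        mul_le_mul_of_nonneg_left hg (ht0 m)
      linarith
    have hκt : κ * t m ≤ ρ₁ ^ m := le_trans (mul_le_of_le_one_left (ht0 m) hκ1) hρb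
    have := neg_abs_le (f m)
    linarith
  -- (A3) `m > N₂`: `|f m| ≤ E·ρ₂^m`, `t m ≤ ρ₁^m`
  have hA3 : ∀ m, N₂ < m → -(ρ₁ ^ m + E * ρ₂ ^ m) ≤ f m - κ * t m := by
    intro m hm
    have hm1 : 1 ≤ m := by omega
    have hmN : ((N₂ : ℝ) + 1) ≤ m := by exact_mod_cast hm
    obtain ⟨_, hρb⟩ := htρ m (lt_of_le_of_lt hN hm)
    have hκt : κ * t m ≤ ρ₁ ^ m := le_trans (mul_le_of_le_one_left (ht0 m) hκ1) hρb
    have hfabs : |f m| ≤ E * ρ₂ ^ m := by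
      have hf2 : (0 : ℝ) < ((2 * m).factorial : ℝ) := by positivity
      have e : |f m| = |b m| * (σ ^ (2 * m) / ((2 * m).factorial : ℝ)) := by
        simp only [hf]
        rw [abs_div, abs_mul, abs_of_nonneg (pow_nonneg hσ _), abs_of_pos hf2, mul_div_assoc]
      rw [e]
      have hw : 0 ≤ σ ^ (2 * m) / ((2 * m).factorial : ℝ) := by positivity
      calc |b m| * (σ ^ (2 * m) / ((2 * m).factorial : ℝ)) ≤ E * (2 * W) ^ m * (σ ^ (2 * m) / ((2 * m).factorial : ℝ)) :=
            mul_le_mul_of_nonneg_right (H2 m hm) hw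
        _ = E * ((2 * W * σ ^ 2) ^ m / ((2 * m).factorial : ℝ)) := by
            rw [mul_pow, mul_pow, ← pow_mul]; ring
        _ ≤ E * (Real.exp 2 * W * σ ^ 2 / (2 * (m : ℝ) ^ 2)) ^ m :=
            mul_le_mul_of_nonneg_left (pow_div_factorial_two_mul_le hW hm1) hE
        _ ≤ E * ρ₂ ^ m := by
            refine mul_le_mul_of_nonneg_left (pow_le_pow_left₀ (by positivity) ?_ m) hE
            refine le_trans ?_ hρ₂
            apply div_le_div_of_nonneg_left (by positivity) (by positivity)
            have : ((N₂ : ℝ) + 1) ^ 2 ≤ (m : ℝ) ^ 2 := by gcongr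
            linarith
    have := neg_abs_le (f m)
    linarith
  -- partial sums from `N₂ + 1` on are `≥ 0`
  have hpartial : ∀ M : ℕ, N₂ + 1 ≤ M → 0 ≤ ∑ m ∈ Finset.range M, (f m - κ * t m) := by
    intro M hM
    rw [← Finset.sum_range_add_sum_Ico _ hM, ← Finset.sum_range_add_sum_Ico _ (Nat.succ_le_succ hN)]
    -- block 1: `m ≤ N₁`
    have hB1 : (1 - η - κ) ≤ ∑ m ∈ Finset.range (N₁ + 1), (f m - κ * t m) := by
      have h1 : ∀ m ∈ Finset.range (N₁ + 1), (1 - η - κ) * t m ≤ f m - κ * t m := by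
        intro m hm
        have := hA1 m (Nat.lt_succ_iff.1 (Finset.mem_range.1 hm))
        nlinarith [ht0 m]
      refine le_trans ?_ (Finset.sum_le_sum h1)
      rw [← Finset.mul_sum]
      have hsum : t 0 ≤ ∑ m ∈ Finset.range (N₁ + 1), t m :=
        Finset.single_le_sum (fun m _ => ht0 m) (Finset.mem_range.2 (Nat.succ_pos N₁))
      have ht00 : t 0 = 1 := by simp [ht]
      have hc : 0 ≤ 1 - η - κ := by simp only [hκ]; linarith
      nlinarith
    -- block 2: `N₁ < m ≤ N₂`
    have hB2 : -(2 * (ρ₁ ^ (N₁ + 1) / (1 - ρ₁))) ≤ ∑ m ∈ Finset.Ico (N₁ + 1) (N₂ + 1), (f m - κ * t m) := by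
      have h1 : ∀ m ∈ Finset.Ico (N₁ + 1) (N₂ + 1), -(2 * ρ₁ ^ m) ≤ f m - κ * t m := by
        intro m hm
        obtain ⟨hm1, hm2⟩ := Finset.mem_Ico.1 hm
        exact hA2 m (by omega) (by omega)
      refine le_trans ?_ (Finset.sum_le_sum h1)
      rw [Finset.sum_neg_distrib, ← Finset.mul_sum, neg_le_neg_iff]
      exact mul_le_mul_of_nonneg_left (geom_sum_Ico_le_of_lt_one hρ₁0 hρ₁1) (by norm_num)
    -- block 3: `m > N₂`
    have hB3 : -(ρ₁ ^ (N₁ + 1) / (1 - ρ₁) + E * (ρ₂ ^ (N₂ + 1) / (1 - ρ₂))) ≤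
        ∑ m ∈ Finset.Ico (N₂ + 1) M, (f m - κ * t m) := by
      have h1 : ∀ m ∈ Finset.Ico (N₂ + 1) M, -(ρ₁ ^ m + E * ρ₂ ^ m) ≤ f m - κ * t m := by
        intro m hm
        exact hA3 m (by have := (Finset.mem_Ico.1 hm).1; omega)
      refine le_trans ?_ (Finset.sum_le_sum h1)
      rw [Finset.sum_neg_distrib, Finset.sum_add_distrib, ← Finset.mul_sum, neg_le_neg_iff]
      have g1 : ∑ m ∈ Finset.Ico (N₂ + 1) M, ρ₁ ^ m ≤ ρ₁ ^ (N₁ + 1) / (1 - ρ₁) := by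
        refine (geom_sum_Ico_le_of_lt_one hρ₁0 hρ₁1).trans ?_
        exact div_le_div_of_nonneg_right (pow_le_pow_of_le_one hρ₁0 hρ₁1.le (by omega)) (by linarith)
      have g2 : ∑ m ∈ Finset.Ico (N₂ + 1) M, ρ₂ ^ m ≤ ρ₂ ^ (N₂ + 1) / (1 - ρ₂) := geom_sum_Ico_le_of_lt_one hρ₂0 hρ₂1
      linarith [mul_le_mul_of_nonneg_left g2 hE]
    have hsum1 : 1 - η - κ = 3 * τ₁ + τ₂ := by simp only [hκ]; ring
    have hE' : E * (ρ₂ ^ (N₂ + 1) / (1 - ρ₂)) ≤ τ₂ := by rw [← mul_div_assoc]; exact hτ₂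
    refine le_trans ?_ (add_le_add (add_le_add hB1 hB2) hB3)
    linarith only [hsum1, hE', hτ₁]
  -- pass to the limit
  have hlim : Tendsto (fun M : ℕ => ∑ m ∈ Finset.range M, (f m - κ * t m)) atTop (𝓝 (S - κ * Φ)) := by
    have h1 := hS.tendsto_sum_nat
    have h2 := (hΦ.mul_left κ).tendsto_sum_nat
    have h3 := h1.sub h2
    refine h3.congr fun M => ?_
    rw [Finset.sum_sub_distrib]
  have hfin := ge_of_tendsto hlim (Filter.eventually_atTop.2 ⟨N₂ + 1, hpartial⟩)
  linarith only [hfin]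

end Summit.RiemannHypothesis.RiemannHypothesis.Theorems.Handoff

end
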